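import Mathlib
import HarnessLib
import Summits.NavierStokesRegularity.NavierStokesRegularity.Theorems.UnthreadedDoorAntidynamoCompositionModuloWall
import Summits.NavierStokesRegularity.NavierStokesRegularity.Theorems.UnthreadedDoorAntidynamoWallInstant
import Summits.NavierStokesRegularity.NavierStokesRegularity.Theorems.UnthreadedDoorAntidynamoWallLocalClosers
import Summits.NavierStokesRegularity.NavierStokesRegularity.Theorems.UnthreadedDoorAntidynamoWallCaloricFarPast

/-!
# Route `UnthreadedDoor` / `ThreadingFlux`, crux `PoloidalLiouville` (stmt-NavierStokesRegularity-1222), antidynamo v2 skeleton (4ebf5683127b),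
# WALL `stub_scalarLiouville`: THE WALL REDUCES TO ITS CORE, BY NAME

Support file (seat leafhand-ns-unthreadeddoor-2 g1, cell decomp-ns), `--supports stmt-NavierStokesRegularity-1222 --as helper`; theorems only.

`stubScalarLiouville_of_core`: to prove the registered wall `Antidynamo.StubScalarLiouville` (hence, by the landed composition p793469, the crux
`PoloidalLiouville` of both routes — `poloidalLiouville_of_core`) it SUFFICES to prove its conclusion for flows of the wall's class that IN ADDITION
(C1) are jointly REAL-ANALYTIC in their given frame on `(−∞,0) × ℝ³`;
(C2) have `{x | curl v(t,x) ≠ 0}` DENSE in `ℝ³` at every `t < 0`;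
(C3) near every `t₀ < 0`, at all times of a punctured neighbourhood, admit NO non-zero direction orthogonal to the vorticity on any non-empty open set
     (no local flat direction / local zonality / local second centre at any set of times accumulating inside `(−∞,0)`);
(C4) are NOT anti-symmetric as a pseudovector about `x₀` under any linear isometry on any far past `(−∞, t₁)`;
(C5) are NOT generalized-Beltrami in any smooth Galilean frame on any far past (`curl((v − b) × ω) ≢ 0`).
Proof: a flow violating one of (C1)–(C5) is irrotational by the landed closers (`CellFlux.unthreadedAnalyticOrIrrotational`,
`dense_curl_ne_zero_or_curl_eq_zero`, `curl_eq_zero_of_local_orthogonal_direction_frequently`, `curl_eq_zero_of_curl_antisymmetric_farPast`,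
`curl_eq_zero_of_lamb_curlFree_farPast`), and an irrotational flow satisfies the wall's conclusion trivially.

HONEST LABEL: a by-name reduction (pure logic over landed closers); the core statement is OPEN (it is the wall on its residual); nothing here proves
`stub_scalarLiouville`, `PoloidalLiouville` (1222), or bears on Navier–Stokes regularity; no summit statement is proved (crux 1222 is INCOMPARABLE with
the summit). [folklore] [cite: KochNadirashviliSereginSverak2009, Thm 5.2 (arXiv:0709.3599 pp. 9–10)]
-/

noncomputable section

-- the summit and its single sub-problem share the name (CONVENTIONS §1)
set_option linter.dupNamespace false

open scoped Topology InnerProductSpace RealInnerProductSpace ContDiff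
open Filter Set Function Metric MeasureTheory
open Literature.Analysis.FluidPDE

namespace Summit.NavierStokesRegularity.NavierStokesRegularity.Theorems.PoloidalLiouville.Antidynamo

open Summit.NavierStokesRegularity.NavierStokesRegularity.Theorems.PoloidalLiouville
  (constantOfIrrotational)

/-- **THE CORE OF THE WALL** (a hypothesis shape, no new definition): the wall's conclusion for the flows of its class satisfying (C1)–(C5) of the
module docstring. -/
theorem stubScalarLiouville_of_core
    (hcore : ∀ (v : ℝ → EuclideanSpace ℝ (Fin 3) → EuclideanSpace ℝ (Fin 3)) (x₀ : EuclideanSpace ℝ (Fin 3))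
      (T : ℝ → EuclideanSpace ℝ (Fin 3) → ℝ),
      Literature.Analysis.FluidPDE.IsBoundedAncientMildSolution 1 v →
      (∀ t < 0, AEStronglyMeasurable (v t) volume) →
      ContDiffOn ℝ (⊤ : ℕ∞) (Function.uncurry v) (Set.Iio 0 ×ˢ Set.univ) →
      ContDiffOn ℝ (⊤ : ℕ∞) (Function.uncurry T) (Set.Iio 0 ×ˢ ({x₀}ᶜ : Set (EuclideanSpace ℝ (Fin 3)))) →
      (∃ C : ℝ, ∀ t < 0, ∀ x, |T t x| ≤ C) →
      (∀ t < 0, ∀ x, Literature.Analysis.FluidPDE.curl (v t) x =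
        Literature.Analysis.FluidPDE.cross (gradient (T t) x) (x - x₀)) →
      (∀ t < 0, ∀ x, x ≠ x₀ →
        Literature.Analysis.FluidPDE.cross
            (gradient (fun z => deriv (fun s => T s z) t + inner ℝ (v t z) (gradient (T t) z)
              - Laplacian.laplacian (T t) z) x) (x - x₀) =
          Literature.Analysis.FluidPDE.cross (gradient (fun z => inner ℝ (v t z) (z - x₀)) x) (gradient (T t) x)) →
      -- (C1) analytic in the given frame
      AnalyticOnNhd ℝ (Function.uncurry v) (Iio (0 : ℝ) ×ˢ (univ : Set (EuclideanSpace ℝ (Fin 3)))) →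
      -- (C2) dense non-vanishing of the vorticity at every time
      (∀ t < 0, Dense {x : EuclideanSpace ℝ (Fin 3) | curl (v t) x ≠ 0}) →
      -- (C3) no local flat direction near any negative time
      (∀ t₀ < 0, ∀ᶠ t in 𝓝[≠] t₀, ¬ ∃ e : EuclideanSpace ℝ (Fin 3), e ≠ 0 ∧
        ∃ U : Set (EuclideanSpace ℝ (Fin 3)), IsOpen U ∧ U.Nonempty ∧ ∀ x ∈ U, ⟪e, curl (v t) x⟫ = 0) →
      -- (C4) not anti-symmetric under any linear isometry on any far past
      (∀ (R : EuclideanSpace ℝ (Fin 3) ≃ₗᵢ[ℝ] EuclideanSpace ℝ (Fin 3)) (t₁ : ℝ), t₁ ≤ 0 →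
        ¬ ∀ t < t₁, ∀ y, curl (v t) (x₀ + R y) =
          -((R : EuclideanSpace ℝ (Fin 3) →L[ℝ] EuclideanSpace ℝ (Fin 3)).det • R (curl (v t) (x₀ + y)))) →
      -- (C5) not generalized-Beltrami in any smooth Galilean frame on any far past
      (∀ (t₁ : ℝ), t₁ ≤ 0 → ∀ b : ℝ → EuclideanSpace ℝ (Fin 3), ContDiffOn ℝ ∞ b (Iio t₁) →
        ¬ ∀ t < t₁, ∀ x, curl (fun y => cross (v t y - b t) (curl (v t) y)) x = 0) →
      ∀ t < 0, ∀ x, Literature.Analysis.FluidPDE.cross (gradient (T t) x) (x - x₀) = 0) :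
    StubScalarLiouville := by
  intro v x₀ T hB hm hsm hT hTb hrep hE
  -- a toroidal field is tangent to the spheres about its centre
  have hun : ∀ t < 0, ∀ x, ⟪x - x₀, curl (v t) x⟫ = 0 := fun t ht x => by
    rw [hrep t ht x]
    simp [cross, crossProduct, PiLp.inner_apply, Fin.sum_univ_three]
    ring
  by_cases h0 : ∀ t < 0, ∀ x, curl (v t) x = 0
  · intro t ht x
    rw [← hrep t ht x]
    exact h0 t ht x
  -- otherwise the flow is in the core
  have hC1 : AnalyticOnNhd ℝ (Function.uncurry v) (Iio (0 : ℝ) ×ˢ (univ : Set (EuclideanSpace ℝ (Fin 3)))) :=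
    (CellFlux.unthreadedAnalyticOrIrrotational v x₀ T hB hm hsm hrep).resolve_right h0
  have hC2 : ∀ t < 0, Dense {x : EuclideanSpace ℝ (Fin 3) | curl (v t) x ≠ 0} :=
    (dense_curl_ne_zero_or_curl_eq_zero v x₀ hB hm hsm hun).resolve_left h0
  have hC3 : ∀ t₀ < 0, ∀ᶠ t in 𝓝[≠] t₀, ¬ ∃ e : EuclideanSpace ℝ (Fin 3), e ≠ 0 ∧
      ∃ U : Set (EuclideanSpace ℝ (Fin 3)), IsOpen U ∧ U.Nonempty ∧ ∀ x ∈ U, ⟪e, curl (v t) x⟫ = 0 := by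
    intro t₀ ht₀
    by_contra hne
    have hfr := Filter.not_eventually.1 hne
    exact h0 (curl_eq_zero_of_local_orthogonal_direction_frequently v x₀ hB hm hsm hun
      ⟨t₀, ht₀, hfr.mono fun t ht => not_not.1 ht⟩)
  have hC4 : ∀ (R : EuclideanSpace ℝ (Fin 3) ≃ₗᵢ[ℝ] EuclideanSpace ℝ (Fin 3)) (t₁ : ℝ), t₁ ≤ 0 →
      ¬ ∀ t < t₁, ∀ y, curl (v t) (x₀ + R y) =
        -((R : EuclideanSpace ℝ (Fin 3) →L[ℝ] EuclideanSpace ℝ (Fin 3)).det • R (curl (v t) (x₀ + y))) :=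
    fun R t₁ ht₁ hanti => h0 (curl_eq_zero_of_curl_antisymmetric_farPast v x₀ hB hm hsm hun R ht₁ hanti)
  have hC5 : ∀ (t₁ : ℝ), t₁ ≤ 0 → ∀ b : ℝ → EuclideanSpace ℝ (Fin 3), ContDiffOn ℝ ∞ b (Iio t₁) →
      ¬ ∀ t < t₁, ∀ x, curl (fun y => cross (v t y - b t) (curl (v t) y)) x = 0 :=
    fun t₁ ht₁ b hb hlamb => h0 (curl_eq_zero_of_lamb_curlFree_farPast v x₀ hB hm hsm hun ht₁ b hb hlamb)
  exact hcore v x₀ T hB hm hsm hT hTb hrep hE hC1 hC2 hC3 hC4 hC5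

/-- **… AND THE CRUX**: the same core statement gives `PoloidalLiouville` (route `UnthreadedDoor` decl; composition p793469 by name). -/
theorem poloidalLiouville_of_core
    (hcore : ∀ (v : ℝ → EuclideanSpace ℝ (Fin 3) → EuclideanSpace ℝ (Fin 3)) (x₀ : EuclideanSpace ℝ (Fin 3))
      (T : ℝ → EuclideanSpace ℝ (Fin 3) → ℝ),
      Literature.Analysis.FluidPDE.IsBoundedAncientMildSolution 1 v →
      (∀ t < 0, AEStronglyMeasurable (v t) volume) →
      ContDiffOn ℝ (⊤ : ℕ∞) (Function.uncurry v) (Set.Iio 0 ×ˢ Set.univ) →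
      ContDiffOn ℝ (⊤ : ℕ∞) (Function.uncurry T) (Set.Iio 0 ×ˢ ({x₀}ᶜ : Set (EuclideanSpace ℝ (Fin 3)))) →
      (∃ C : ℝ, ∀ t < 0, ∀ x, |T t x| ≤ C) →
      (∀ t < 0, ∀ x, Literature.Analysis.FluidPDE.curl (v t) x =
        Literature.Analysis.FluidPDE.cross (gradient (T t) x) (x - x₀)) →
      (∀ t < 0, ∀ x, x ≠ x₀ →
        Literature.Analysis.FluidPDE.cross
            (gradient (fun z => deriv (fun s => T s z) t + inner ℝ (v t z) (gradient (T t) z)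
              - Laplacian.laplacian (T t) z) x) (x - x₀) =
          Literature.Analysis.FluidPDE.cross (gradient (fun z => inner ℝ (v t z) (z - x₀)) x) (gradient (T t) x)) →
      AnalyticOnNhd ℝ (Function.uncurry v) (Iio (0 : ℝ) ×ˢ (univ : Set (EuclideanSpace ℝ (Fin 3)))) →
      (∀ t < 0, Dense {x : EuclideanSpace ℝ (Fin 3) | curl (v t) x ≠ 0}) →
      (∀ t₀ < 0, ∀ᶠ t in 𝓝[≠] t₀, ¬ ∃ e : EuclideanSpace ℝ (Fin 3), e ≠ 0 ∧
        ∃ U : Set (EuclideanSpace ℝ (Fin 3)), IsOpen U ∧ U.Nonempty ∧ ∀ x ∈ U, ⟪e, curl (v t) x⟫ = 0) →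
      (∀ (R : EuclideanSpace ℝ (Fin 3) ≃ₗᵢ[ℝ] EuclideanSpace ℝ (Fin 3)) (t₁ : ℝ), t₁ ≤ 0 →
        ¬ ∀ t < t₁, ∀ y, curl (v t) (x₀ + R y) =
          -((R : EuclideanSpace ℝ (Fin 3) →L[ℝ] EuclideanSpace ℝ (Fin 3)).det • R (curl (v t) (x₀ + y)))) →
      (∀ (t₁ : ℝ), t₁ ≤ 0 → ∀ b : ℝ → EuclideanSpace ℝ (Fin 3), ContDiffOn ℝ ∞ b (Iio t₁) →
        ¬ ∀ t < t₁, ∀ x, curl (fun y => cross (v t y - b t) (curl (v t) y)) x = 0) →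
      ∀ t < 0, ∀ x, Literature.Analysis.FluidPDE.cross (gradient (T t) x) (x - x₀) = 0) :
    Summit.NavierStokesRegularity.NavierStokesRegularity.Theses.UnthreadedDoor.PoloidalLiouville :=
  poloidalLiouville_of_stubScalarLiouville' (stubScalarLiouville_of_core hcore)

end Summit.NavierStokesRegularity.NavierStokesRegularity.Theorems.PoloidalLiouville.Antidynamo

end
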